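/-
Copyright (c) 2026 the pub-hodgecm-mathlib formalisation cell (harness21).  Prover seat hodgecm-mathlib-A-p16 (g32): road «S3-ram» (LEAD F0P3a-plan (g13); owner∕table
F0P3a-p06 (g15)), the (a2) JUNCTION (J★) of F0P3a-p01 (g17) — organ «(J★) HEAD modulo the CONFIGURATION COUNTS», FILE 3: the configuration-independent PER-LITERAL
TRANSPORT PACKAGE (frame, `u`-normalised `J₀`-literal, class constants, D→J₀ count identity) shared by the equilateral (★ p847798) and isoceles head branches; 2026-09-02.
-/
import Literature.NumberTheory.Automorphic.UnitaryLatticeTreeTypeOneLiteralFrames                      -- ★ p847627 (F0P3a-p05 (g17)): frames of the four literals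
import Literature.NumberTheory.Automorphic.UnitaryLatticeTreeCentralRescalingCountTransport             -- ★ p847541 (F0P3a-p05 (g17)): D→J₀ transport
import Literature.NumberTheory.Automorphic.UnitaryLatticeTreeDiagonalLiteralAntidiagonalModel           -- ★ p847564 (F0P3a-p05 (g17)): the `u`-normalised literal in `U(J₀) ∩ GL₃(𝒪)`
import Literature.NumberTheory.Automorphic.UnitaryLatticeTreeResiduallyUnipotentCorner                  -- ★ `residue_eq_zero_iff_v_lt_one`
import HarnessLib

/-!
# The ramified type-(1) `κ`-orbital integral: the PER-LITERAL TRANSPORT PACKAGE of the junction head — for each of the four literals `b`, an integral antidiagonal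
# frame, the `u`-normalised literal in `U(J₀) ∩ GL₃(𝒪)`, the class constants and their common residual constant, and the identity «head counts = `J₀`-model counts»
# (Rogawski 1990 §4.9; Kottwitz 1986 §3; Bruhat–Tits 1972 §10)

Topic `NumberTheory/Rogawski1990`; namespace `Literature.NumberTheory.Rogawski1990`.  THEOREMS ONLY (no definition, no instance, no notation, no named fact, no `sorry`); kernel
lane `--supports stmt-HodgeConjecture-24833`; datum-free over the abstract lattice model.  Cell `pub/hodgecm-mathlib` (D-0151), crux H413; road «S3-ram» (Literature seeding,
count-neutral), fold of record v7.7∕v7.8 socket (J★) :164; junction pen F0P3a-p01 (g17), skeleton v11 (5af0312e): two engine statements `strataCount_J₀_equilateral` (:764) and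
`strataCount_J₀_isoceles` (:1187) in the `J₀`-MODEL, while the head counts `T = diag(α,u,γ)`-fixed self-dual lattices for the four DIAGONAL forms `diag d_b`,
`d_b = (ε^b₁u₀, ε^b₂u₁, ε^(b₁+b₂)u₂)`, with class constants `c₀, c₀ε`.  ORGAN «(J★) HEAD modulo the CONFIGURATION COUNTS» (A-p16 (g32); p01 «=» 01:50:26Z (3)), FILE 3:
THIS FILE packages, ONCE for both configurations, the literal-by-literal step that the equilateral head ★ p847798 performed inline:
**`exists_transport_typeOne_literal`** — for each `b` there are a frame `A` (`A, A⁻¹` integral, `diag d_b = (−det diag d_b)·ᵗσ(A)J₀A`, ★ p847627), a literal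
`γ′ ∈ U(σ,J₀) ∩ GL₃(𝒪)` with `γ′ = A·diag(α∕u, 1, γ∕u)·A⁻¹` and the spectrum facts `s 1 = 1`, `|sᵢ| = 1`, `sᵢσ(sᵢ) = 1` (★ p847564), a unit `c₁ = (−det diag d_b)⁻¹c₀` with
`𝒪`-versions `cP = −c₁`, `cM = −(c₁ε)` of the two class constants whose residual constants are the COMMON `−c̄₀⁻¹` resp. `ε̄⁻¹·(−c̄₀⁻¹)` (so all four literals read one class,
its `ε`-twist flipping `χ`), and the COUNT IDENTITY «the five head counts of literal `b` = the five `J₀`-model counts of `γ′` with constants `c₁, c₁ε`» for every stratum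
(★ p847541 `ncard_strata_diagonal_eq_ncard_strata_antidiagonal_of_central` with `T″ := A⁻¹γ′A`, `A T″ A⁻¹ = γ′`).  The head-set text is the (J★) conclusion's summand set
VERBATIM (`b`, `j` free); the `J₀`-set text is the engines' left-hand side VERBATIM (`γ ↦ γ′`).
HONEST LABEL: HC_CM is proved only modulo the 2 remaining named inputs (hLiu418 24832, h413 24833) until rung 0 closes; nothing printed is asserted here (bookkeeping).

## References
* [Rogawski1990] J. D. Rogawski, *Automorphic Representations of Unitary Groups in Three Variables*, Ann. of Math. Stud. 123 (1990), §4.9 Prop. 4.9.1 (a)(b) p. 55, Lemma 4.9.3.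
* [Kottwitz1986] R. E. Kottwitz, *Base change for unit elements of Hecke algebras*, Compositio Math. 60 (1986), §3 (counting fixed lattices in a convenient model).
* [BruhatTits1972] F. Bruhat, J. Tits, *Groupes réductifs sur un corps local I*, Publ. Math. IHÉS 41 (1972), §10 (functoriality of the building in the form).
-/

set_option autoImplicit false

noncomputable section

open scoped Valued WithZero Matrix MatrixGroups
open Polynomial Finset
open Literature.NumberTheory.Automorphic Literature.NumberTheory.Automorphic.HermitianLattice Literature.NumberTheory.Automorphic.UnitaryLatticeTree

namespace Literature.NumberTheory.Rogawski1990

variable {K : Type*} [Field K] [Valued K ℤᵐ⁰] {σ : K →+* K} {ϖ : K}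

set_option maxHeartbeats 1600000 in  -- large VERBATIM set texts (five strata × two models); generous headroom, whole file ≈ 11 s on the farm
/-- **THE PER-LITERAL TRANSPORT PACKAGE** (see the module docstring): frame, `u`-normalised `J₀`-literal, class constants with their common residual constant, and the
five-strata count identity «head model = `J₀`-model» for the literal `b`. [cite: Rogawski1990, §4.9 Prop. 4.9.1 (a) p. 55, Lemma 4.9.3] [cite: Kottwitz1986, §3]
[cite: BruhatTits1972, §10] -/
theorem exists_transport_typeOne_literal
    (hσ : ∀ x, σ (σ x) = x) (hvσ : ∀ a, Valued.v (σ a) = Valued.v a) (hϖ : Valued.v ϖ = WithZero.exp (-1 : ℤ))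
    (hres : ∀ x : K, Valued.v x ≤ 1 → Valued.v (σ x - x) < 1) (h2 : Valued.v (2 : K) = 1)
    (hnorm : ∀ u : K, σ u = u → Valued.v (u - 1) < 1 → ∃ z : K, z * σ z = u ∧ Valued.v (z - 1) ≤ Valued.v (u - 1)) [Fintype 𝓀[K]]
    (u₀ u₁ u₂ ε c₀ : 𝒪[K]) (hu₀ : Valued.v (u₀ : K) = 1) (hu₁ : Valued.v (u₁ : K) = 1) (hu₂ : Valued.v (u₂ : K) = 1) (hεv : Valued.v (ε : K) = 1) (hc₀ : Valued.v (c₀ : K) = 1)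
    (hσu₀ : σ u₀ = u₀) (hσu₁ : σ u₁ = u₁) (hσu₂ : σ u₂ = u₂) (hσε : σ ε = ε)
    (α u γ : K) (hα : α * σ α = 1) (hu : u * σ u = 1) (hγ : γ * σ γ = 1)
    (hα2 : Valued.v (α - 1) ≤ Valued.v ϖ ^ 2) (hu2 : Valued.v (u - 1) ≤ Valued.v ϖ ^ 2) (hγ2 : Valued.v (γ - 1) ≤ Valued.v ϖ ^ 2)
    (T : GL (Fin 3) K) (hT : (T : Matrix (Fin 3) (Fin 3) K) = Matrix.diagonal ![α, u, γ]) (b : Fin 2 × Fin 2) :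
    ∃ (A : GL (Fin 3) K) (γ' : unitaryGroupOfForm σ ((StdForm.antidiagonal 3).over K)) (c₁ : K) (cP cM : 𝒪[K]),
      IsIntMatrix (A : Matrix (Fin 3) (Fin 3) K) ∧ IsIntMatrix ((A⁻¹ : GL (Fin 3) K) : Matrix (Fin 3) (Fin 3) K) ∧
      Matrix.diagonal (![((ε : K)) ^ (b.1 : ℕ) * (u₀ : K), (ε : K) ^ (b.2 : ℕ) * (u₁ : K), (ε : K) ^ ((b.1 : ℕ) + (b.2 : ℕ)) * (u₂ : K)] : Fin 3 → K) = (-(Matrix.diagonal (![((ε : K)) ^ (b.1 : ℕ) * (u₀ : K), (ε : K) ^ (b.2 : ℕ) * (u₁ : K), (ε : K) ^ ((b.1 : ℕ) + (b.2 : ℕ)) * (u₂ : K)] : Fin 3 → K)).det) • formCongr σ A ((StdForm.antidiagonal 3).over K) ∧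
      γ' ∈ unitaryInt σ ((StdForm.antidiagonal 3).over K) ∧
      ((γ' : GL (Fin 3) K) : Matrix (Fin 3) (Fin 3) K) = (A : Matrix (Fin 3) (Fin 3) K) * Matrix.diagonal ![α / u, 1, γ / u] * ((A⁻¹ : GL (Fin 3) K) : Matrix (Fin 3) (Fin 3) K) ∧
      (![α / u, 1, γ / u] : Fin 3 → K) 1 = 1 ∧ (∀ i, Valued.v ((![α / u, 1, γ / u] : Fin 3 → K) i) = 1) ∧
      (∀ i, (![α / u, 1, γ / u] : Fin 3 → K) i * σ ((![α / u, 1, γ / u] : Fin 3 → K) i) = 1) ∧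
      Valued.v c₁ = 1 ∧ (cP : K) = -c₁ ∧ (cM : K) = -(c₁ * (ε : K)) ∧
      (IsLocalRing.residue 𝒪[K] cP)⁻¹ * (IsLocalRing.residue 𝒪[K] (-∏ i, (![ε ^ (b.1 : ℕ) * u₀, ε ^ (b.2 : ℕ) * u₁, ε ^ ((b.1 : ℕ) + (b.2 : ℕ)) * u₂] : Fin 3 → 𝒪[K]) i))⁻¹ = -(IsLocalRing.residue 𝒪[K] c₀)⁻¹ ∧
      (IsLocalRing.residue 𝒪[K] cM)⁻¹ * (IsLocalRing.residue 𝒪[K] (-∏ i, (![ε ^ (b.1 : ℕ) * u₀, ε ^ (b.2 : ℕ) * u₁, ε ^ ((b.1 : ℕ) + (b.2 : ℕ)) * u₂] : Fin 3 → 𝒪[K]) i))⁻¹ = (IsLocalRing.residue 𝒪[K] ε)⁻¹ * (-(IsLocalRing.residue 𝒪[K] c₀)⁻¹) ∧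
      ∀ j : Fin 5, ({M : Submodule (Valued.integer K) (Fin 3 → K) |
              IsSelfDualLattice σ ϖ (Matrix.diagonal ![((ε : K)) ^ (b.1 : ℕ) * (u₀ : K), (ε : K) ^ (b.2 : ℕ) * (u₁ : K), (ε : K) ^ ((b.1 : ℕ) + (b.2 : ℕ)) * (u₂ : K)]) M ∧ mapGL T M = M ∧
                (![-- bd : `¬ (T − 1)M ⊆ ϖM`
                    ¬ M.map ((Matrix.toLin' ((T : Matrix (Fin 3) (Fin 3) K) - 1)).restrictScalars (Valued.integer K)) ≤ scaleLattice ϖ M,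
                  -- reg : depth 1, rank 2
                    M.map ((Matrix.toLin' ((T : Matrix (Fin 3) (Fin 3) K) - 1)).restrictScalars (Valued.integer K)) ≤ scaleLattice ϖ M ∧
                      ¬ M.map ((Matrix.toLin' ((T : Matrix (Fin 3) (Fin 3) K) - 1)).restrictScalars (Valued.integer K)) ≤ scaleLattice (ϖ ^ 2) M ∧
                      ¬ M.map ((Matrix.toLin' (((T : Matrix (Fin 3) (Fin 3) K) - 1) ^ 2)).restrictScalars (Valued.integer K)) ≤ scaleLattice (ϖ ^ 3) M,
                  -- 1s : depth 1, rank 1, class `c₀`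
                    M.map ((Matrix.toLin' ((T : Matrix (Fin 3) (Fin 3) K) - 1)).restrictScalars (Valued.integer K)) ≤ scaleLattice ϖ M ∧
                      ¬ M.map ((Matrix.toLin' ((T : Matrix (Fin 3) (Fin 3) K) - 1)).restrictScalars (Valued.integer K)) ≤ scaleLattice (ϖ ^ 2) M ∧
                      M.map ((Matrix.toLin' (((T : Matrix (Fin 3) (Fin 3) K) - 1) ^ 2)).restrictScalars (Valued.integer K)) ≤ scaleLattice (ϖ ^ 3) M ∧
                      ∃ y ∈ M, ∃ a : K, Valued.v a = 1 ∧
                        Valued.v (ϖ⁻¹ * pairing σ (Matrix.diagonal ![((ε : K)) ^ (b.1 : ℕ) * (u₀ : K), (ε : K) ^ (b.2 : ℕ) * (u₁ : K), (ε : K) ^ ((b.1 : ℕ) + (b.2 : ℕ)) * (u₂ : K)]) y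
                          (((T : Matrix (Fin 3) (Fin 3) K) - 1) *ᵥ y) - (c₀ : K) * a ^ 2) < 1,
                  -- 1n : depth 1, rank 1, class `c₀·ε`
                    M.map ((Matrix.toLin' ((T : Matrix (Fin 3) (Fin 3) K) - 1)).restrictScalars (Valued.integer K)) ≤ scaleLattice ϖ M ∧
                      ¬ M.map ((Matrix.toLin' ((T : Matrix (Fin 3) (Fin 3) K) - 1)).restrictScalars (Valued.integer K)) ≤ scaleLattice (ϖ ^ 2) M ∧
                      M.map ((Matrix.toLin' (((T : Matrix (Fin 3) (Fin 3) K) - 1) ^ 2)).restrictScalars (Valued.integer K)) ≤ scaleLattice (ϖ ^ 3) M ∧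
                      ∃ y ∈ M, ∃ a : K, Valued.v a = 1 ∧
                        Valued.v (ϖ⁻¹ * pairing σ (Matrix.diagonal ![((ε : K)) ^ (b.1 : ℕ) * (u₀ : K), (ε : K) ^ (b.2 : ℕ) * (u₁ : K), (ε : K) ^ ((b.1 : ℕ) + (b.2 : ℕ)) * (u₂ : K)]) y
                          (((T : Matrix (Fin 3) (Fin 3) K) - 1) *ᵥ y) - (c₀ : K) * (ε : K) * a ^ 2) < 1,
                  -- 0 : depth ≥ 2
                    M.map ((Matrix.toLin' ((T : Matrix (Fin 3) (Fin 3) K) - 1)).restrictScalars (Valued.integer K)) ≤ scaleLattice (ϖ ^ 2) M] : Fin 5 → Prop) j}).ncard = ({M : Submodule 𝒪[K] (Fin 3 → K) | IsSelfDualLattice σ ϖ ((StdForm.antidiagonal 3).over K) M ∧ mapGL (γ' : GL (Fin 3) K) M = M ∧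
        (![¬ M.map ((Matrix.toLin' (((γ' : GL (Fin 3) K) : Matrix (Fin 3) (Fin 3) K) - 1)).restrictScalars 𝒪[K]) ≤ scaleLattice ϖ M,
                  M.map ((Matrix.toLin' (((γ' : GL (Fin 3) K) : Matrix (Fin 3) (Fin 3) K) - 1)).restrictScalars 𝒪[K]) ≤ scaleLattice ϖ M ∧
                    ¬ M.map ((Matrix.toLin' (((γ' : GL (Fin 3) K) : Matrix (Fin 3) (Fin 3) K) - 1)).restrictScalars 𝒪[K]) ≤ scaleLattice (ϖ ^ 2) M ∧
                    ¬ M.map ((Matrix.toLin' ((((γ' : GL (Fin 3) K) : Matrix (Fin 3) (Fin 3) K) - 1) ^ 2)).restrictScalars 𝒪[K]) ≤ scaleLattice (ϖ ^ 3) M,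
                  M.map ((Matrix.toLin' (((γ' : GL (Fin 3) K) : Matrix (Fin 3) (Fin 3) K) - 1)).restrictScalars 𝒪[K]) ≤ scaleLattice ϖ M ∧
                    ¬ M.map ((Matrix.toLin' (((γ' : GL (Fin 3) K) : Matrix (Fin 3) (Fin 3) K) - 1)).restrictScalars 𝒪[K]) ≤ scaleLattice (ϖ ^ 2) M ∧
                    M.map ((Matrix.toLin' ((((γ' : GL (Fin 3) K) : Matrix (Fin 3) (Fin 3) K) - 1) ^ 2)).restrictScalars 𝒪[K]) ≤ scaleLattice (ϖ ^ 3) M ∧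
                    ∃ y ∈ M, ∃ a : K, Valued.v a = 1 ∧
                      Valued.v (ϖ⁻¹ * pairing σ (((StdForm.antidiagonal 3).over K)) y
                        ((((γ' : GL (Fin 3) K) : Matrix (Fin 3) (Fin 3) K) - 1) *ᵥ y) - c₁ * a ^ 2) < 1,
                  M.map ((Matrix.toLin' (((γ' : GL (Fin 3) K) : Matrix (Fin 3) (Fin 3) K) - 1)).restrictScalars 𝒪[K]) ≤ scaleLattice ϖ M ∧
                    ¬ M.map ((Matrix.toLin' (((γ' : GL (Fin 3) K) : Matrix (Fin 3) (Fin 3) K) - 1)).restrictScalars 𝒪[K]) ≤ scaleLattice (ϖ ^ 2) M ∧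
                    M.map ((Matrix.toLin' ((((γ' : GL (Fin 3) K) : Matrix (Fin 3) (Fin 3) K) - 1) ^ 2)).restrictScalars 𝒪[K]) ≤ scaleLattice (ϖ ^ 3) M ∧
                    ∃ y ∈ M, ∃ a : K, Valued.v a = 1 ∧
                      Valued.v (ϖ⁻¹ * pairing σ (((StdForm.antidiagonal 3).over K)) y
                        ((((γ' : GL (Fin 3) K) : Matrix (Fin 3) (Fin 3) K) - 1) *ᵥ y) - c₁ * (ε : K) * a ^ 2) < 1,
                  M.map ((Matrix.toLin' (((γ' : GL (Fin 3) K) : Matrix (Fin 3) (Fin 3) K) - 1)).restrictScalars 𝒪[K]) ≤ scaleLattice (ϖ ^ 2) M] : Fin 5 → Prop) j}).ncard := by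
  classical
  have hres0 : ∀ x : 𝒪[K], Valued.v (x : K) = 1 → IsLocalRing.residue 𝒪[K] x ≠ 0 := fun x hx h => by
    rw [residue_eq_zero_iff_v_lt_one, hx] at h
    exact lt_irrefl _ h
  have huv : Valued.v u = 1 := v_eq_one_of_mul_map_eq_one hvσ hu
  have hαv : Valued.v α = 1 := v_eq_one_of_mul_map_eq_one hvσ hα
  have hγv : Valued.v γ = 1 := v_eq_one_of_mul_map_eq_one hvσ hγ
  obtain ⟨hd, hdσ, Ab, hAb, hAb', hdA⟩ := exists_frame_literalDiag u₀ u₁ u₂ ε b hσ hvσ hres h2 hnorm hu₀ hu₁ hu₂ hεv hσu₀ hσu₁ hσu₂ hσε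
  obtain ⟨hs1, hsv, hsσ, γ', hγ'0, hγ'A⟩ := exists_mem_unitaryInt_coe_eq_conj_diagonal_div hvσ hd hAb hAb' hdA hα hu hγ
  -- the `𝒪`-version of `d_b`
  let d₀ : Fin 3 → 𝒪[K] := ![ε ^ (b.1 : ℕ) * u₀, ε ^ (b.2 : ℕ) * u₁, ε ^ ((b.1 : ℕ) + (b.2 : ℕ)) * u₂]
  have hd₀0 : d₀ 0 = ε ^ (b.1 : ℕ) * u₀ := rfl
  have hd₀1 : d₀ 1 = ε ^ (b.2 : ℕ) * u₁ := rfl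
  have hd₀2 : d₀ 2 = ε ^ ((b.1 : ℕ) + (b.2 : ℕ)) * u₂ := rfl
  have hd₀ : ∀ i, (d₀ i : K) = (![((ε : K)) ^ (b.1 : ℕ) * (u₀ : K), (ε : K) ^ (b.2 : ℕ) * (u₁ : K), (ε : K) ^ ((b.1 : ℕ) + (b.2 : ℕ)) * (u₂ : K)] : Fin 3 → K) i := by
    intro i
    fin_cases i
    · show ((d₀ 0 : 𝒪[K]) : K) = (ε : K) ^ (b.1 : ℕ) * (u₀ : K)
      rw [hd₀0]; push_cast; rfl
    · show ((d₀ 1 : 𝒪[K]) : K) = (ε : K) ^ (b.2 : ℕ) * (u₁ : K)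
      rw [hd₀1]; push_cast; rfl
    · show ((d₀ 2 : 𝒪[K]) : K) = (ε : K) ^ ((b.1 : ℕ) + (b.2 : ℕ)) * (u₂ : K)
      rw [hd₀2]; push_cast; rfl
  have hprod : (((-∏ i, d₀ i : 𝒪[K])) : K) = -(Matrix.diagonal (![((ε : K)) ^ (b.1 : ℕ) * (u₀ : K), (ε : K) ^ (b.2 : ℕ) * (u₁ : K), (ε : K) ^ ((b.1 : ℕ) + (b.2 : ℕ)) * (u₂ : K)] : Fin 3 → K)).det := by
    rw [Matrix.det_diagonal]
    push_cast
    exact congrArg Neg.neg (Finset.prod_congr rfl fun i _ => hd₀ i)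
  -- `T″ = A⁻¹γ′A` and its conjugate
  have hT'' : ((Ab⁻¹ * (γ' : GL (Fin 3) K) * Ab : GL (Fin 3) K) : Matrix (Fin 3) (Fin 3) K) = Matrix.diagonal ![α / u, 1, γ / u] := by
    rw [Units.val_mul, Units.val_mul, hγ'A]
    simp only [Matrix.mul_assoc, Units.inv_mul, Matrix.mul_one]
    rw [← Matrix.mul_assoc, Units.inv_mul, Matrix.one_mul]
  have hconj : Ab * (Ab⁻¹ * (γ' : GL (Fin 3) K) * Ab) * Ab⁻¹ = (γ' : GL (Fin 3) K) := by group
  -- the transport constant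
  have hDv : Valued.v (((-∏ i, d₀ i : 𝒪[K])) : K) = 1 := by
    push_cast
    rw [Valuation.map_neg, map_prod]
    exact Finset.prod_eq_one fun i _ => by rw [hd₀ i]; exact hd i
  have hD0 : (((-∏ i, d₀ i : 𝒪[K])) : K) ≠ 0 := fun h => by rw [h, map_zero] at hDv; exact zero_ne_one hDv
  set c₁ : K := ((((-∏ i, d₀ i : 𝒪[K])) : K))⁻¹ * (c₀ : K) with hc₁def
  have hc : (c₀ : K) = -(Matrix.diagonal (![((ε : K)) ^ (b.1 : ℕ) * (u₀ : K), (ε : K) ^ (b.2 : ℕ) * (u₁ : K), (ε : K) ^ ((b.1 : ℕ) + (b.2 : ℕ)) * (u₂ : K)] : Fin 3 → K)).det * c₁ := by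
    rw [← hprod, hc₁def, mul_inv_cancel_left₀ hD0]
  have hc₁v : Valued.v c₁ = 1 := by rw [hc₁def, map_mul, map_inv₀, hDv, inv_one, one_mul, hc₀]
  have hcP : Valued.v (-c₁) = 1 := by rw [Valuation.map_neg, hc₁v]
  have hcM : Valued.v (-(c₁ * (ε : K))) = 1 := by rw [Valuation.map_neg, map_mul, hc₁v, hεv, one_mul]
  let cP : 𝒪[K] := ⟨-c₁, (Valuation.mem_integer_iff _ _).2 hcP.le⟩
  let cM : 𝒪[K] := ⟨-(c₁ * (ε : K)), (Valuation.mem_integer_iff _ _).2 hcM.le⟩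
  have hcPD : cP * (-∏ i, d₀ i) = -c₀ := by
    apply Subtype.ext
    push_cast
    show -c₁ * (((-∏ i, d₀ i : 𝒪[K])) : K) = -(c₀ : K)
    rw [hc₁def]; field_simp
  have hcMD : cM * (-∏ i, d₀ i) = -(c₀ * ε) := by
    apply Subtype.ext
    push_cast
    show -(c₁ * (ε : K)) * (((-∏ i, d₀ i : 𝒪[K])) : K) = -((c₀ : K) * (ε : K))
    rw [hc₁def]; field_simp
  have hc₀' := hres0 c₀ hc₀
  have hε' := hres0 ε hεv
  have hconstP : (IsLocalRing.residue 𝒪[K] cP)⁻¹ * (IsLocalRing.residue 𝒪[K] (-∏ i, d₀ i))⁻¹ = -(IsLocalRing.residue 𝒪[K] c₀)⁻¹ := by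
    rw [← mul_inv, ← map_mul, hcPD, map_neg, neg_inv]
  have hconstM : (IsLocalRing.residue 𝒪[K] cM)⁻¹ * (IsLocalRing.residue 𝒪[K] (-∏ i, d₀ i))⁻¹ = (IsLocalRing.residue 𝒪[K] ε)⁻¹ * (-(IsLocalRing.residue 𝒪[K] c₀)⁻¹) := by
    rw [← mul_inv, ← map_mul, hcMD, map_neg, map_mul]
    field_simp
  refine ⟨Ab, γ', c₁, cP, cM, hAb, hAb', hdA, hγ'0, hγ'A, hs1, hsv, hsσ, hc₁v, rfl, rfl, hconstP, hconstM, fun j => ?_⟩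
  have htr := ncard_strata_diagonal_eq_ncard_strata_antidiagonal_of_central hvσ hϖ _ hd hdσ Ab hdA α u γ hαv huv hγv hα2 hu2 hγ2 T
    (Ab⁻¹ * (γ' : GL (Fin 3) K) * Ab) hT hT'' (c₀ : K) c₁ (ε : K) hc₀ hc j
  rw [hconj] at htr
  exact htr

end Literature.NumberTheory.Rogawski1990

end
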